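import Summits.ResolutionOfSingularities.ResolutionOfSingularities.Theorems.PurelyInseparableDim4ResConeCInfLayerPrime
import Summits.ResolutionOfSingularities.ResolutionOfSingularities.Theorems.PurelyInseparableDim4ResConeCInfTranslatedStepSigma
import HarnessLib
import HarnessLib.Audit.Tags

/-!
# Purely inseparable four-folds — the LETTER-CHANGE LAYER LEMMA, every σ = (n, n) + 0 and every prime: the `1 ↦ n` edition of
# FILE ♯2 `…ResConeCInfLayerPrime` (cell `res-dim4-pi`, K2(p) lane, class (iii) rows σ = (n, n) + 0, flagless branch, FILE ♯2σ)

[OURS · counted 0 · cell `res-dim4-pi` · K2(p) lane (holder res-dim4-p-12 g5, ruling g5-33 «(σ♭) = the `1 ↦ n` port ♯1σ/♯2σ/♯2bσ/TSσ/C♯σ/(I♭)σ»;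
res-dim4-p-3 g6's MEMO `res-dim4-p-3/MEMO-g6-FLAGLESS-SHARP.md` §2 (LC); conventions of res-dim4-typ-1 g6 (bus 2026-08-29 15:49Z);
typed by the width seat res-dim4-p-13 g6 by signature).]  Nothing here proves K2(p) for any `p`, any TAIL(p, d, 3), FLAGLESS♯,
`NoIsolatedTrap p p`, the Cossart–Jannsen–Saito theorem or resolution of singularities in dimension ≥ 4 / characteristic `p` — NOT proved.
AI kernel work, weaker than expert review.  Exponent algebra about OUR frame; it kills nothing by itself.

SETTING.  Twin slots `j, i` of weight `n ≥ 1`, free letter `u`, contact letter `f`; `n + d = p`, `2 ≤ d`; F-exponents `(e_j, e_i, e_u, e_f)`;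
STRAIGHT = order `p + n` with the cone `x_j^n x_i^n x_f^d` as only degree-`(p + n)` exponent; σ-LEDGER = «`e_f ≤ d − 1 ⇒ e_j, e_i ≥ n + 1`»;
σ-FLAG row = `x_j^{n+1} x_i^{n+1} x_u^{d−1−c} x_f^{c}`, `c + 2 ≤ d` (res-dim4-p-7 g6's ♯1σ `coeff_flag_step_translate_u_sigma` carries it
through a translated slot step).  For `n = 1` (`d + 1 = p`) every statement below is literally the corresponding statement of FILE ♯2; the
weight-free §1 of FILE ♯2 (`line_eq_zero_of_hasse_vanish`, `exists_parent_of_mem_support_step_translate_u`) is used by name.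
* §1 **`ledger_degree_step_translate_u_sigma`** — σ-LEDGER TRANSPORT with the degree rider: the child of the translated slot step
  `step p univ j (update 0 u β) s` (ANY `β`) of a straight σ-ledger parent again has the σ-ledger, and its monomials with `e_j = n + 1` and
  `e_f ≤ d − 1` (residual `κ`-exponent `1`) have degree `≤ p + n + 1` (res-dim4-typ-1 g6's TSσ `ledger_step_translate_u_sigma` is the first
  conjunct; this file needs the rider).
* §2 **`letterChange_layer_sigma`** — THE LETTER-CHANGE LAYER LEMMA, σ-edition: parent straight with the σ-ledger; `s₁` = `κ`-step (β),
  `s₂` = `o`-step (β′) of `s₁`, both IN REGIME (degree `≥ p + n + 1` or the cone) and `s₁` σ-FLAGLESS ⇒ the parent has NO monomial of degree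
  `p + n + 1` with `e_f + 2 ≤ d`.  STEP 1: every monomial of `s₁` with `e_j = n + 1`, `e_f + 2 ≤ d` vanishes (its `o`-line's Hasse sums are
  coefficients of `s₂` below the order, except the top one, which is a σ-FLAG of `s₂` = the σ-FLAG of `s₁` by ♯1σ, zero); STEP 2: the
  degree-`(p + n + 1)` `κ`-lines of the parent have all their Hasse sums among the STEP-1 coefficients.
[cite: Hauser2010, §§F–G] [cite: CossartJannsenSaito2020, Lemma 13.2, Thm. 3.14]
bears_on: LADDER-RESOLUTION:D157-DOOR2 (res-dim4-pi · K2(p) · power cones · class (iii) σ = (n,n)+0 flagless branch ♯2σ).  Supports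
stmt-ResolutionOfSingularities-16155 (helper).
-/

set_option linter.dupNamespace false -- mandated namespace of this single-conjunct summit

noncomputable section

namespace Summit.ResolutionOfSingularities.ResolutionOfSingularities.Theorems.PIDim4

namespace ResCone

open MvPolynomial Finset
open Literature.AlgebraicGeometry.Resolution
open Literature.AlgebraicGeometry.Resolution.CentreBlowup
open Literature.AlgebraicGeometry.Resolution.Hauser2010
open Literature.AlgebraicGeometry.Resolution.HauserPerlega2019

variable {K : Type} [Field K] [DecidableEq K]

section Step

variable {j i u f : Fin 4} (hji : j ≠ i) (hju : j ≠ u) (hjf : j ≠ f) (hiu : i ≠ u) (hif : i ≠ f) (huf : u ≠ f)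
include hji hju hjf hiu hif huf

/-! ## 1. σ-ledger transport with the degree rider -/

/-- **σ-LEDGER TRANSPORT, translated slot step, with the degree rider** (`n + d = p`, `2 ≤ d`): from a parent of order `≥ p + n` whose only
degree-`(p + n)` monomial is the cone `x_j^n x_i^n x_f^d` and which has the σ-ledger, the child of the slot step in the chart of `j` translated
by ANY `β·e_u` again has the σ-ledger, and its monomials with `e_j = n + 1` and `e_f ≤ d − 1` have degree `≤ p + n + 1`. The `n = 1` case is
FILE ♯2's `ledger_step_translate_u`. [OURS] [cite: CossartJannsenSaito2020, Lemma 13.2] -/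
theorem ledger_degree_step_translate_u_sigma (p : ℕ) {n d : ℕ} (hd2 : 2 ≤ d) (s : State K)
    (hq : ((p : ℕ) : ℕ∞) ≤ ordAlong Finset.univ s.F) (h6 : ∀ e ∈ s.F.support, p + n ≤ e.degree)
    (hstraight : ∀ e ∈ s.F.support, e.degree = p + n →
      e = Finsupp.single j n + Finsupp.single i n + Finsupp.single u 0 + Finsupp.single f d)
    (hled : ∀ e ∈ s.F.support, e f ≤ d - 1 → n + 1 ≤ e j ∧ n + 1 ≤ e i) (β : K) :
    (∀ E ∈ (CentreBlowup.step p Finset.univ j (Function.update (0 : Fin 4 → K) u β) s).F.support,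
        E f ≤ d - 1 → n + 1 ≤ E j ∧ n + 1 ≤ E i) ∧
      (∀ E ∈ (CentreBlowup.step p Finset.univ j (Function.update (0 : Fin 4 → K) u β) s).F.support,
        E f ≤ d - 1 → E j = n + 1 → E.degree ≤ p + n + 1) := by
  have key : ∀ E ∈ (CentreBlowup.step p Finset.univ j (Function.update (0 : Fin 4 → K) u β) s).F.support, E f ≤ d - 1 →
      ∃ δ ∈ s.F.support, δ.degree = E j + p ∧ δ i = E i ∧ δ f = E f ∧ E u ≤ δ u ∧ n + 1 ≤ δ j ∧ n + 1 ≤ δ i ∧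
        p + n + 1 ≤ δ.degree := by
    intro E hE hEf
    obtain ⟨δ, hmem, hm, hi, hf, hu⟩ := exists_parent_of_mem_support_step_translate_u hji hju hjf hiu hif huf p s hq β hE
    have hled' := hled δ hmem (by rw [hf]; exact hEf)
    refine ⟨δ, hmem, hm, hi, hf, hu, hled'.1, hled'.2, ?_⟩
    have h6' := h6 δ hmem
    rcases Nat.eq_or_lt_of_le h6' with heq | hlt
    · exfalso
      have hc := hstraight δ hmem heq.symm
      have := (quad_apply hji hju hjf hiu hif huf n n 0 d).2.2.2
      rw [← hc] at this
      rw [this] at hf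
      omega
    · omega
  refine ⟨fun E hE hEf => ?_, fun E hE hEf hEj => ?_⟩
  · obtain ⟨δ, -, hm, hi, -, -, -, hδi, hdeg⟩ := key E hE hEf
    exact ⟨by omega, by rw [← hi]; exact hδi⟩
  · obtain ⟨δ, -, hm, hi, hf, hu, hδj, -, -⟩ := key E hE hEf
    have h1 := degree_eq_quad hji hju hjf hiu hif huf δ
    have h2 := degree_eq_quad hji hju hjf hiu hif huf E
    omega

/-! ## 2. The letter-change layer lemma, σ-edition -/

/-- **THE LETTER-CHANGE LAYER LEMMA, every σ = (n, n) + 0 and every prime** (`n + d = p`, `2 ≤ d`).  Parent `s`: order `≥ p + n`, straight,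
σ-ledger.  `s₁` = slot step in the chart of `j` translated by `β·e_u`, `s₂` = slot step of `s₁` in the chart of the OTHER slot `i` translated
by `β′·e_u`, both IN REGIME (every monomial has degree `≥ p + n + 1` or is the cone) and `s₁` σ-FLAGLESS
(`coeff x_j^{n+1} x_i^{n+1} x_u^{d−1−c} x_f^c s₁.F = 0` for `c + 2 ≤ d`).  Then the parent has NO monomial of degree `p + n + 1` with contact
exponent `e_f + 2 ≤ d`. The `n = 1` case is FILE ♯2's `letterChange_layer_prime`. [OURS] [cite: Hauser2010, §§F–G]
[cite: CossartJannsenSaito2020, Thm. 3.14] -/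
theorem letterChange_layer_sigma (p : ℕ) {n d : ℕ} (hσ : n + d = p) (hd2 : 2 ≤ d) (s : State K)
    (hq : ((p : ℕ) : ℕ∞) ≤ ordAlong Finset.univ s.F) (h6 : ∀ e ∈ s.F.support, p + n ≤ e.degree)
    (hstraight : ∀ e ∈ s.F.support, e.degree = p + n →
      e = Finsupp.single j n + Finsupp.single i n + Finsupp.single u 0 + Finsupp.single f d)
    (hled : ∀ e ∈ s.F.support, e f ≤ d - 1 → n + 1 ≤ e j ∧ n + 1 ≤ e i) (β β' : K)
    (hq₁ : ((p : ℕ) : ℕ∞) ≤ ordAlong Finset.univ (CentreBlowup.step p Finset.univ j (Function.update (0 : Fin 4 → K) u β) s).F)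
    (hreg₁ : ∀ E ∈ (CentreBlowup.step p Finset.univ j (Function.update (0 : Fin 4 → K) u β) s).F.support,
      p + n + 1 ≤ E.degree ∨ E = Finsupp.single j n + Finsupp.single i n + Finsupp.single u 0 + Finsupp.single f d)
    (hflag₁ : ∀ c, c + 2 ≤ d →
      coeff (Finsupp.single j (n + 1) + Finsupp.single i (n + 1) + Finsupp.single u (d - 1 - c) + Finsupp.single f c)
        (CentreBlowup.step p Finset.univ j (Function.update (0 : Fin 4 → K) u β) s).F = 0)
    (hreg₂ : ∀ E ∈ (CentreBlowup.step p Finset.univ i (Function.update (0 : Fin 4 → K) u β')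
        (CentreBlowup.step p Finset.univ j (Function.update (0 : Fin 4 → K) u β) s)).F.support,
      p + n + 1 ≤ E.degree ∨ E = Finsupp.single j n + Finsupp.single i n + Finsupp.single u 0 + Finsupp.single f d) :
    ∀ E : Fin 4 →₀ ℕ, E.degree = p + n + 1 → E f + 2 ≤ d → coeff E s.F = 0 := by
  classical
  set s₁ := CentreBlowup.step p Finset.univ j (Function.update (0 : Fin 4 → K) u β) s with hs₁
  set s₂ := CentreBlowup.step p Finset.univ i (Function.update (0 : Fin 4 → K) u β') s₁ with hs₂
  obtain ⟨hled₁, hdeg₁⟩ := ledger_degree_step_translate_u_sigma hji hju hjf hiu hif huf p hd2 s hq h6 hstraight hled β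
  -- STEP 1: every monomial of `s₁` with `e_j = n + 1` and `e_f + 2 ≤ d` vanishes.
  have step1 : ∀ E₁ : Fin 4 →₀ ℕ, E₁ j = n + 1 → E₁ f + 2 ≤ d → coeff E₁ s₁.F = 0 := by
    intro E₁ hE₁j hE₁f
    by_contra hne
    have hmem : E₁ ∈ s₁.F.support := mem_support_iff.mpr hne
    have hdeg : E₁.degree = p + n + 1 := by
      have hle := hdeg₁ E₁ hmem (by omega) hE₁j
      rcases hreg₁ E₁ hmem with hge | hc
      · omega
      · exfalso
        have := (quad_apply hji hju hjf hiu hif huf n n 0 d).1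
        rw [← hc, hE₁j] at this
        omega
    set c := E₁ f with hc
    -- the `o`-line of `E₁` in `s₁` (frozen `e_j = n + 1`, `e_f = c`, degree `p + n + 1`); members have `e_i ≥ n + 1`,
    -- so `e_u ≤ d − 1 − c`
    have htop : ∀ δ ∈ s₁.F.support, δ.degree = p + n + 1 → δ j = n + 1 → δ f = c → δ u ≤ d - 1 - c := by
      intro δ hδ hm hj' hf'
      have h2 := (hled₁ δ hδ (by omega)).2
      have := degree_eq_quad hji hju hjf hiu hif huf δ
      omega
    have hvan : ∀ J, J ≤ d - 1 - c →
        ∑ δ ∈ s₁.F.support with (δ.degree = p + n + 1 ∧ δ j = n + 1 ∧ δ f = c),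
          ((δ u).choose J : K) * β' ^ (δ u - J) * coeff δ s₁.F = 0 := by
      intro J hJ
      set γ' : Fin 4 →₀ ℕ := Finsupp.single j (n + 1) + Finsupp.single u J + Finsupp.single f c with hγ'
      have hγ'i : γ' i = 0 := by
        rw [hγ', Finsupp.add_apply, Finsupp.add_apply, Finsupp.single_eq_of_ne hji.symm, Finsupp.single_eq_of_ne hiu,
          Finsupp.single_eq_of_ne hif]; simp
      have hγ'j : γ' j = n + 1 := by
        rw [hγ', Finsupp.add_apply, Finsupp.add_apply, Finsupp.single_eq_same, Finsupp.single_eq_of_ne hju,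
          Finsupp.single_eq_of_ne hjf]; simp
      have hγ'u : γ' u = J := by
        rw [hγ', Finsupp.add_apply, Finsupp.add_apply, Finsupp.single_eq_of_ne hju.symm, Finsupp.single_eq_same,
          Finsupp.single_eq_of_ne huf]; simp
      have hγ'f : γ' f = c := by
        rw [hγ', Finsupp.add_apply, Finsupp.add_apply, Finsupp.single_eq_of_ne hjf.symm, Finsupp.single_eq_of_ne huf.symm,
          Finsupp.single_eq_same]; simp
      have hnp : ¬ IsPthPowerExponent p (γ' + Finsupp.single i (p + n + 1 - p)) := by
        rw [isPthPowerExponent_iff]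
        intro h
        have h2 := h i
        rw [Finsupp.add_apply, hγ'i, zero_add, Finsupp.single_eq_same, show p + n + 1 - p = n + 1 by omega] at h2
        have := Nat.le_of_dvd (by omega) h2
        omega
      have key := coeff_step_translate_u hji.symm hiu hif hju hjf huf p s₁ hq₁ β' (show p ≤ p + n + 1 by omega) γ' hγ'i hnp
      simp only [hγ'j, hγ'u, hγ'f] at key
      rw [← key]
      -- the child exponent: below degree `p + n + 1` unless `J` is the top, where it is a σ-FLAG of `s₂`
      rcases Nat.lt_or_ge J (d - 1 - c) with hlt | hge
      · refine notMem_support_iff.mp fun hmem₂ => ?_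
        rcases hreg₂ _ hmem₂ with hge | hcone
        · have hdegγ : (γ' + Finsupp.single i (p + n + 1 - p)).degree = n + 1 + J + c + (p + n + 1 - p) := by
            rw [map_add, Finsupp.degree_single, hγ', map_add, map_add, Finsupp.degree_single, Finsupp.degree_single,
              Finsupp.degree_single]
          rw [hdegγ] at hge
          omega
        · have hj2 : (γ' + Finsupp.single i (p + n + 1 - p)) j =
              (Finsupp.single j n + Finsupp.single i n + Finsupp.single u 0 + Finsupp.single f d : Fin 4 →₀ ℕ) j := by
            rw [hcone]
          rw [Finsupp.add_apply, hγ'j, Finsupp.single_eq_of_ne hji, (quad_apply hji hju hjf hiu hif huf n n 0 d).1] at hj2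
          omega
      · have hJ' : J = d - 1 - c := le_antisymm hJ hge
        have hexp : γ' + Finsupp.single i (p + n + 1 - p) =
            Finsupp.single i (n + 1) + Finsupp.single j (n + 1) + Finsupp.single u (d - 1 - c) + Finsupp.single f c := by
          rw [show p + n + 1 - p = n + 1 by omega, hγ', hJ']
          abel
        rw [hexp, coeff_flag_step_translate_u_sigma hji.symm hiu hif hju hjf huf p hσ hd2 s₁ hq₁
          (fun e he hef => (hled₁ e he hef).2) β' (show c + 2 ≤ d by omega), ← gameExp_swap, hflag₁ c (by omega)]
    exact hne (line_eq_zero_of_hasse_vanish hji.symm hiu hif hju hjf huf s₁.F (p + n + 1) (n + 1) c β' (d - 1 - c) htop hvan E₁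
      hdeg hE₁j rfl)
  -- STEP 2: the degree-`(p + n + 1)` `κ`-lines of `s` with `e_f + 2 ≤ d` have all their Hasse sums among the STEP-1 coefficients.
  intro E hEdeg hEf
  by_contra hne
  have hmem : E ∈ s.F.support := mem_support_iff.mpr hne
  obtain ⟨hEj, hEi⟩ := hled E hmem (by omega)
  have htop : ∀ δ ∈ s.F.support, δ.degree = p + n + 1 → δ i = E i → δ f = E f → δ u ≤ d + n - E i - E f := by
    intro δ hδ hm hi' hf'
    have h2 := (hled δ hδ (by omega)).1
    have := degree_eq_quad hji hju hjf hiu hif huf δ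
    omega
  have hvan : ∀ J, J ≤ d + n - E i - E f →
      ∑ δ ∈ s.F.support with (δ.degree = p + n + 1 ∧ δ i = E i ∧ δ f = E f),
        ((δ u).choose J : K) * β ^ (δ u - J) * coeff δ s.F = 0 := by
    intro J hJ
    set γ : Fin 4 →₀ ℕ := Finsupp.single i (E i) + Finsupp.single u J + Finsupp.single f (E f) with hγ
    have hγj : γ j = 0 := by
      rw [hγ, Finsupp.add_apply, Finsupp.add_apply, Finsupp.single_eq_of_ne hji, Finsupp.single_eq_of_ne hju,
        Finsupp.single_eq_of_ne hjf]; simp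
    have hγi : γ i = E i := by
      rw [hγ, Finsupp.add_apply, Finsupp.add_apply, Finsupp.single_eq_same, Finsupp.single_eq_of_ne hiu,
        Finsupp.single_eq_of_ne hif]; simp
    have hγu : γ u = J := by
      rw [hγ, Finsupp.add_apply, Finsupp.add_apply, Finsupp.single_eq_of_ne hiu.symm, Finsupp.single_eq_same,
        Finsupp.single_eq_of_ne huf]; simp
    have hγf : γ f = E f := by
      rw [hγ, Finsupp.add_apply, Finsupp.add_apply, Finsupp.single_eq_of_ne hif.symm, Finsupp.single_eq_of_ne huf.symm,
        Finsupp.single_eq_same]; simp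
    have hnp : ¬ IsPthPowerExponent p (γ + Finsupp.single j (p + n + 1 - p)) := by
      rw [isPthPowerExponent_iff]
      intro h
      have h2 := h j
      rw [Finsupp.add_apply, hγj, zero_add, Finsupp.single_eq_same, show p + n + 1 - p = n + 1 by omega] at h2
      have := Nat.le_of_dvd (by omega) h2
      omega
    have key := coeff_step_translate_u hji hju hjf hiu hif huf p s hq β (show p ≤ p + n + 1 by omega) γ hγj hnp
    simp only [hγi, hγu, hγf] at key
    rw [← key]
    refine step1 _ ?_ ?_
    · rw [Finsupp.add_apply, hγj, zero_add, Finsupp.single_eq_same]; omega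
    · rw [Finsupp.add_apply, hγf, Finsupp.single_eq_of_ne hjf.symm, add_zero]; exact hEf
  exact hne (line_eq_zero_of_hasse_vanish hji hju hjf hiu hif huf s.F (p + n + 1) (E i) (E f) β (d + n - E i - E f) htop hvan E
    hEdeg rfl rfl)

end Step

end ResCone

end Summit.ResolutionOfSingularities.ResolutionOfSingularities.Theorems.PIDim4
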